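import Summits.AnomalousDissipation.AnomalousDissipation.Theorems.SolenoidalFractalHomogenisationLagrangianStepTrimLevel
import Summits.AnomalousDissipation.AnomalousDissipation.Theorems.SolenoidalFractalHomogenisationLagrangianStepTemplateAsymptotics
import Literature.Analysis.FluidPDE.HeatKernelTailBounds
import Summits.AnomalousDissipation.AnomalousDissipation.Theorems.SolenoidalFractalHomogenisationLagrangianRenormalisationStepTailLevels
import HarnessLib

/-!
# K1L_D (stmt-AnomalousDissipation-27980), stub `stub_windowFactsH`, task W0b: the TEMPLATE SUPER-SMALL TOOLKIT
# (helper; `--supports … --as helper`; lead-k1l-onelevel-p1 g3)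

The operator-level window facts carry ONE explicit super-small slop `ε = ρ^σw · (1 − e^(−4π² kbar_m lo)) · refresh (m+1)` and the glue
(`windowDefectH_of_windowFactsPinned`, p667311) absorbs only multiples of it.  Every producer of a super-small term (band kill (Hi): `e₁ = e^(−rateLo·τ/2)`,
`e₂ = (C₂ θ(m+1))^J`; hop/label tails) must therefore show `term ≤ ε` for `m ≥ m⋆(E)`.  This file is the arithmetic toolkit for that, in the separation
variable `s_m = (N(m+1)/N m)^(1/16) = ρ^(−1/16)` of `…TemplateAsymptotics`:
* § 1 the refresh window is eventually short: `refresh (m+1) ≤ θ(m+1)/a 1 ≤ θ₀/(a 1 · s_m)` (strain clause (S) + (T4)), hence `≤ 1/4` eventually;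
* § 2 POLYNOMIAL LOWER BOUNDS for the slop: `a(m+1)·cellVisc(m+1)·refresh(m+1) ≥ M·W.period·s_m` ((T5) + period formula); `kbar m ≤ kbar 0` (antitone, …TailLevels);
  `kbar m ≥ gain·a(m+1)/(cellVisc(m+1)·N(m+1)²)` (Taylor recursion); hence `kbar m · refresh(m+1) ≥ gain·M·W.period/(N(m+1)²·cellVisc(m+1))·…`
  and `refresh (m+1) ≥ M·W.period·s_m/(kbar 0 · N(m+1)²)`;
* § 3 the SUPER-SMALL side: the eventual comparison «exponential of a negative power of `ρ` ≤ any polynomial» (via the tree's `e^(−x) ≤ n!/xⁿ`).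
Pure real arithmetic on `FractalCarrierData`/`LagrangianLatticeCarrier` + the template hypotheses; no carrier analysis, no definitions, no sorry.
NOT a proof of the stub, of the crux, or of AD; rung F-D1.A0.
-/

set_option linter.dupNamespace false

noncomputable section

namespace Summit.AnomalousDissipation.AnomalousDissipation.Theorems.SolenoidalFractalHomogenisation.LagrangianStep

open Filter Topology
open Literature.Analysis.FluidPDE.LatticeShear
open Summit.AnomalousDissipation.AnomalousDissipation.Theorems.SolenoidalFractalHomogenisation.LagrangianRenormalisationStep (cellVisc_pos' kbar_succ_le kbar_le_of_le)

variable {k : ℕ}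

/-! ## § 1 The refresh window is eventually short -/

/-- Strain clause (S) + `a 1 ≤ Σ_{i<m} a (i+1)`: `refresh (m+1) ≤ θ (m+1) / a 1` for `m ≥ 1`. -/
theorem refresh_succ_le_theta_div (E : LagrangianLatticeCarrier k) (hL : E.LPermissible) {m : ℕ} (hm : 1 ≤ m) :
    E.refresh (m + 1) ≤ E.θ (m + 1) / E.a 1 := by
  have ha1 : 0 < E.a 1 := E.a_pos 1
  have hstrain : (∑ i ∈ Finset.range m, E.a (i + 1)) * E.refresh (m + 1) ≤ E.θ (m + 1) := hL.2.2.2.2.1 m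
  have hsum : E.a 1 ≤ ∑ i ∈ Finset.range m, E.a (i + 1) := by
    have : E.a (0 + 1) ≤ ∑ i ∈ Finset.range m, E.a (i + 1) :=
      Finset.single_le_sum (f := fun i => E.a (i + 1)) (fun i _ => (E.a_pos (i + 1)).le) (Finset.mem_range.2 hm)
    simpa using this
  have hr : 0 < E.refresh (m + 1) := E.refresh_pos (m + 1)
  rw [le_div_iff₀ ha1]
  calc E.refresh (m + 1) * E.a 1 = E.a 1 * E.refresh (m + 1) := mul_comm _ _
    _ ≤ (∑ i ∈ Finset.range m, E.a (i + 1)) * E.refresh (m + 1) := mul_le_mul_of_nonneg_right hsum hr.le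
    _ ≤ E.θ (m + 1) := hstrain

/-- With (T4): `refresh (m+1) ≤ θ₀ / (a 1 · s_m)` for `m ≥ 1`. -/
theorem refresh_succ_le_of_T4 (E : LagrangianLatticeCarrier k) (hL : E.LPermissible) {θ₀ : ℝ}
    (hT4 : ∀ m, E.θ (m + 1) * ((E.N (m + 1) : ℝ) / E.N m) ^ (1 / 16 : ℝ) ≤ θ₀) {m : ℕ} (hm : 1 ≤ m) :
    E.refresh (m + 1) ≤ θ₀ / (E.a 1 * ((E.N (m + 1) : ℝ) / E.N m) ^ (1 / 16 : ℝ)) := by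
  have ha1 : 0 < E.a 1 := E.a_pos 1
  have hs : 0 < ((E.N (m + 1) : ℝ) / E.N m) ^ (1 / 16 : ℝ) := sep16_pos E.toFractalCarrierData m
  have h1 := refresh_succ_le_theta_div E hL hm
  have h2 : E.θ (m + 1) ≤ θ₀ / ((E.N (m + 1) : ℝ) / E.N m) ^ (1 / 16 : ℝ) := by
    rw [le_div_iff₀ hs]; exact hT4 m
  calc E.refresh (m + 1) ≤ E.θ (m + 1) / E.a 1 := h1
    _ ≤ (θ₀ / ((E.N (m + 1) : ℝ) / E.N m) ^ (1 / 16 : ℝ)) / E.a 1 := div_le_div_of_nonneg_right h2 ha1.le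
    _ = θ₀ / (E.a 1 * ((E.N (m + 1) : ℝ) / E.N m) ^ (1 / 16 : ℝ)) := by rw [div_div, mul_comm]

/-- **Eventually `refresh (m+1) ≤ δ`** for every `δ > 0` (the window facts use `δ = 1/4`). -/
theorem exists_forall_refresh_succ_le (E : LagrangianLatticeCarrier k) (hL : E.LPermissible)
    (hsq : ∀ m, E.N m ^ 2 ≤ E.N (m + 1)) {θ₀ : ℝ}
    (hT4 : ∀ m, E.θ (m + 1) * ((E.N (m + 1) : ℝ) / E.N m) ^ (1 / 16 : ℝ) ≤ θ₀) {δ : ℝ} (hδ : 0 < δ) :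
    ∃ mstar : ℕ, ∀ m, mstar ≤ m → E.refresh (m + 1) ≤ δ := by
  have ha1 : 0 < E.a 1 := E.a_pos 1
  obtain ⟨m₀, hm₀⟩ := exists_forall_le_sep16 E.toFractalCarrierData hL.1 hsq (θ₀ / (E.a 1 * δ))
  refine ⟨max 1 m₀, fun m hm => ?_⟩
  have hm1 : 1 ≤ m := le_trans (le_max_left _ _) hm
  have hs : θ₀ / (E.a 1 * δ) ≤ ((E.N (m + 1) : ℝ) / E.N m) ^ (1 / 16 : ℝ) := hm₀ m (le_trans (le_max_right _ _) hm)
  have hspos : 0 < ((E.N (m + 1) : ℝ) / E.N m) ^ (1 / 16 : ℝ) := sep16_pos E.toFractalCarrierData m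
  have h := refresh_succ_le_of_T4 E hL hT4 hm1
  calc E.refresh (m + 1) ≤ θ₀ / (E.a 1 * ((E.N (m + 1) : ℝ) / E.N m) ^ (1 / 16 : ℝ)) := h
    _ ≤ δ := by
      rw [div_le_iff₀ (mul_pos ha1 hspos)]
      rw [div_le_iff₀ (mul_pos ha1 hδ)] at hs
      nlinarith

/-! ## § 2 Polynomial lower bounds for the slop -/

/-- (T5) + the period formula: `M · W.period · s_m ≤ a (m+1) · cellVisc (m+1) · refresh (m+1)`. -/
theorem MWp_sep16_le_a_cellVisc_refresh (E : LagrangianLatticeCarrier k) {W : LatticeWord k} {M : ℝ} {hM : 0 < M}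
    (hW : E.design = W.stretch M hM)
    (hT5 : ∀ m, ((E.N (m + 1) : ℝ) / E.N m) ^ (1 / 16 : ℝ) * E.physPeriod (m + 1) ≤ E.refresh (m + 1)) (m : ℕ) :
    M * W.period * ((E.N (m + 1) : ℝ) / E.N m) ^ (1 / 16 : ℝ) ≤ E.a (m + 1) * E.cellVisc (m + 1) * E.refresh (m + 1) := by
  have hν : 0 < E.cellVisc (m + 1) := cellVisc_pos' E.toFractalCarrierData (m + 1)
  have ha : 0 < E.a (m + 1) := E.a_pos (m + 1)
  have hP : E.physPeriod (m + 1) = M * W.period / (E.cellVisc (m + 1) * E.a (m + 1)) := physPeriod_eq E.toFractalCarrierData hW (m + 1)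
  have h := hT5 m
  rw [hP] at h
  have hva : 0 < E.cellVisc (m + 1) * E.a (m + 1) := mul_pos hν ha
  have h2 : ((E.N (m + 1) : ℝ) / E.N m) ^ (1 / 16 : ℝ) * (M * W.period) ≤ E.refresh (m + 1) * (E.cellVisc (m + 1) * E.a (m + 1)) := by
    have := mul_le_mul_of_nonneg_right h hva.le
    rwa [mul_div_assoc', div_mul_cancel₀ _ hva.ne'] at this
  nlinarith

/-- `kbar m ≤ kbar 0` (`kbar` is antitone, `…TailLevels.kbar_le_of_le`). -/
theorem kbar_le_kbar_zero (D : FractalCarrierData k) (hP : D.Permissible) (m : ℕ) : D.kbar m ≤ D.kbar 0 :=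
  kbar_le_of_le D hP (Nat.zero_le m)

/-- Taylor recursion, cell form: `gain · a (m+1) / (cellVisc (m+1) · N (m+1)²) ≤ kbar m`. -/
theorem gain_mul_a_div_le_kbar (D : FractalCarrierData k) (hP : D.Permissible) (m : ℕ) :
    D.gain * D.a (m + 1) / (D.cellVisc (m + 1) * (D.N (m + 1) : ℝ) ^ 2) ≤ D.kbar m := by
  have hν : 0 < D.cellVisc (m + 1) := cellVisc_pos' D (m + 1)
  have hN : (0 : ℝ) < D.N (m + 1) := by exact_mod_cast D.N_pos (m + 1)
  have h := kbar_ge_gain_div D hP m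
  have hk : D.kbar (m + 1) = D.a (m + 1) * (1 / (D.N (m + 1) : ℝ) ^ 2 * D.cellVisc (m + 1)) := kbar_eq_a_mul D (m + 1)
  rw [hk] at h
  have e : D.a (m + 1) * (1 / (D.N (m + 1) : ℝ) ^ 2 * D.cellVisc (m + 1)) * (D.gain / D.cellVisc (m + 1) ^ 2)
      = D.gain * D.a (m + 1) / (D.cellVisc (m + 1) * (D.N (m + 1) : ℝ) ^ 2) := by
    field_simp
  rw [e] at h
  exact h

/-- **`kbar m · refresh (m+1)` is polynomially large**: `gain · M · W.period · s_m / (cellVisc (m+1)² · N (m+1)²) ≤ kbar m · refresh (m+1)`. -/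
theorem kbar_mul_refresh_ge (E : LagrangianLatticeCarrier k) {W : LatticeWord k} {M : ℝ} {hM : 0 < M}
    (hW : E.design = W.stretch M hM) (hL : E.LPermissible)
    (hT5 : ∀ m, ((E.N (m + 1) : ℝ) / E.N m) ^ (1 / 16 : ℝ) * E.physPeriod (m + 1) ≤ E.refresh (m + 1)) (m : ℕ) :
    E.gain * (M * W.period) * ((E.N (m + 1) : ℝ) / E.N m) ^ (1 / 16 : ℝ) / (E.cellVisc (m + 1) ^ 2 * (E.N (m + 1) : ℝ) ^ 2)
      ≤ E.kbar m * E.refresh (m + 1) := by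
  have hν : 0 < E.cellVisc (m + 1) := cellVisc_pos' E.toFractalCarrierData (m + 1)
  have hN : (0 : ℝ) < E.N (m + 1) := by exact_mod_cast E.N_pos (m + 1)
  have hr : 0 < E.refresh (m + 1) := E.refresh_pos (m + 1)
  have hg : 0 < E.gain := E.gain_pos
  have h1 := MWp_sep16_le_a_cellVisc_refresh E hW hT5 m
  have h2 := gain_mul_a_div_le_kbar E.toFractalCarrierData hL.1 m
  -- `kbar m · r ≥ gain a/(ν n²) · r = gain (a ν r)/(ν² n²) ≥ gain M Wp s/(ν² n²)`
  have h3 : E.gain * E.a (m + 1) / (E.cellVisc (m + 1) * (E.N (m + 1) : ℝ) ^ 2) * E.refresh (m + 1) ≤ E.kbar m * E.refresh (m + 1) :=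
    mul_le_mul_of_nonneg_right h2 hr.le
  have e : E.gain * E.a (m + 1) / (E.cellVisc (m + 1) * (E.N (m + 1) : ℝ) ^ 2) * E.refresh (m + 1)
      = E.gain * (E.a (m + 1) * E.cellVisc (m + 1) * E.refresh (m + 1)) / (E.cellVisc (m + 1) ^ 2 * (E.N (m + 1) : ℝ) ^ 2) := by
    field_simp
  rw [e] at h3
  have h4 : E.gain * (M * W.period * ((E.N (m + 1) : ℝ) / E.N m) ^ (1 / 16 : ℝ)) / (E.cellVisc (m + 1) ^ 2 * (E.N (m + 1) : ℝ) ^ 2)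
      ≤ E.gain * (E.a (m + 1) * E.cellVisc (m + 1) * E.refresh (m + 1)) / (E.cellVisc (m + 1) ^ 2 * (E.N (m + 1) : ℝ) ^ 2) :=
    div_le_div_of_nonneg_right (mul_le_mul_of_nonneg_left h1 hg.le) (by positivity)
  calc _ = E.gain * (M * W.period * ((E.N (m + 1) : ℝ) / E.N m) ^ (1 / 16 : ℝ)) / (E.cellVisc (m + 1) ^ 2 * (E.N (m + 1) : ℝ) ^ 2) := by ring
    _ ≤ _ := h4.trans h3

/-- **`refresh (m+1)` is polynomially large relative to `kbar 0`**: `M · W.period · s_m / (kbar 0 · N (m+1)²) ≤ refresh (m+1)`. -/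
theorem refresh_succ_ge (E : LagrangianLatticeCarrier k) {W : LatticeWord k} {M : ℝ} {hM : 0 < M}
    (hW : E.design = W.stretch M hM) (hL : E.LPermissible)
    (hT5 : ∀ m, ((E.N (m + 1) : ℝ) / E.N m) ^ (1 / 16 : ℝ) * E.physPeriod (m + 1) ≤ E.refresh (m + 1)) (m : ℕ) :
    M * W.period * ((E.N (m + 1) : ℝ) / E.N m) ^ (1 / 16 : ℝ) / (E.kbar 0 * (E.N (m + 1) : ℝ) ^ 2) ≤ E.refresh (m + 1) := by
  have hN : (0 : ℝ) < E.N (m + 1) := by exact_mod_cast E.N_pos (m + 1)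
  have hk0 : 0 < E.kbar 0 := E.kbar_pos 0
  have hr : 0 < E.refresh (m + 1) := E.refresh_pos (m + 1)
  have h1 := MWp_sep16_le_a_cellVisc_refresh E hW hT5 m
  -- `a ν = kbar (m+1) N(m+1)² ≤ kbar 0 N(m+1)²`
  have h2 : E.a (m + 1) * E.cellVisc (m + 1) = E.kbar (m + 1) * (E.N (m + 1) : ℝ) ^ 2 :=
    (kbar_mul_N_sq E.toFractalCarrierData (m + 1)).symm
  have h3 : E.kbar (m + 1) * (E.N (m + 1) : ℝ) ^ 2 ≤ E.kbar 0 * (E.N (m + 1) : ℝ) ^ 2 :=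
    mul_le_mul_of_nonneg_right (kbar_le_kbar_zero E.toFractalCarrierData hL.1 (m + 1)) (by positivity)
  rw [div_le_iff₀ (by positivity)]
  calc M * W.period * ((E.N (m + 1) : ℝ) / E.N m) ^ (1 / 16 : ℝ) ≤ E.a (m + 1) * E.cellVisc (m + 1) * E.refresh (m + 1) := h1
    _ = E.kbar (m + 1) * (E.N (m + 1) : ℝ) ^ 2 * E.refresh (m + 1) := by rw [h2]
    _ ≤ E.kbar 0 * (E.N (m + 1) : ℝ) ^ 2 * E.refresh (m + 1) := mul_le_mul_of_nonneg_right h3 hr.le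
    _ = E.refresh (m + 1) * (E.kbar 0 * (E.N (m + 1) : ℝ) ^ 2) := by ring

/-- `1 − e^(−x) ≥ ¼ min(1, x)` (from the tree) in the form used for the floor factor: `¼ min(1, 4π² kbar_m lo) ≤ 1 − e^(−4π² kbar_m lo)`. -/
theorem floor_factor_ge (D : FractalCarrierData k) {lo : ℝ} (hlo : 0 < lo) (m : ℕ) :
    (1 / 4) * min 1 (4 * Real.pi ^ 2 * (D.kbar m * lo)) ≤ 1 - Real.exp (-(4 * Real.pi ^ 2 * (D.kbar m * lo))) :=
  one_sub_exp_neg_ge_quarter_min (by have := D.kbar_pos m; positivity)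

/-! ## § 3 The super-small side -/

/-- **Exponential beats polynomial along the template**: if `x_m ≥ c · s_m ^ a` with `c > 0`, `a ≥ 1`, then for every `B > 0` and `p : ℕ`,
eventually `e^(−x_m) · s_m ^ p ≤ B` (take `n = p + 1` in `e^(−x) ≤ n!/xⁿ` and let `s_m → ∞`). -/
theorem exists_forall_exp_neg_mul_pow_le (D : FractalCarrierData k) (hP : D.Permissible) (hsq : ∀ m, D.N m ^ 2 ≤ D.N (m + 1))
    (x : ℕ → ℝ) {c : ℝ} (hc : 0 < c) {a : ℕ} (ha : 1 ≤ a)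
    (hx : ∀ m, c * (((D.N (m + 1) : ℝ) / D.N m) ^ (1 / 16 : ℝ)) ^ a ≤ x m) (p : ℕ) {B : ℝ} (hB : 0 < B) :
    ∃ mstar : ℕ, ∀ m, mstar ≤ m → Real.exp (-(x m)) * (((D.N (m + 1) : ℝ) / D.N m) ^ (1 / 16 : ℝ)) ^ p ≤ B := by
  -- with `n := p + 1`: `e^{-x} s^p ≤ (p+1)!/x^{p+1} · s^p ≤ (p+1)!/(c^{p+1} s^{a(p+1)}) · s^p ≤ (p+1)!/(c^{p+1} s)` since `a(p+1) ≥ p+1`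
  obtain ⟨m₀, hm₀⟩ := exists_forall_le_sep16 D hP hsq (((p + 1).factorial : ℝ) / (c ^ (p + 1) * B))
  refine ⟨m₀, fun m hm => ?_⟩
  set s : ℝ := ((D.N (m + 1) : ℝ) / D.N m) ^ (1 / 16 : ℝ) with hs_def
  have hs1 : 1 ≤ s := one_le_sep16 D hP m
  have hs0 : 0 < s := by linarith
  have hxm : 0 < x m := lt_of_lt_of_le (by positivity) (hx m)
  have h1 : Real.exp (-(x m)) ≤ ((p + 1).factorial : ℝ) / x m ^ (p + 1) :=
    Literature.Analysis.FluidPDE.exp_neg_le_factorial_div_pow hxm (p + 1)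
  have h2 : (c * s ^ a) ^ (p + 1) ≤ x m ^ (p + 1) := pow_le_pow_left₀ (by positivity) (hx m) (p + 1)
  have h3 : Real.exp (-(x m)) ≤ ((p + 1).factorial : ℝ) / (c * s ^ a) ^ (p + 1) :=
    h1.trans (div_le_div_of_nonneg_left (by positivity) (by positivity) h2)
  -- `s^p / (s^a)^{p+1} ≤ 1/s`
  have h4 : s ^ p * s ≤ (s ^ a) ^ (p + 1) := by
    rw [← pow_succ, ← pow_mul]
    exact pow_le_pow_right₀ hs1 (by nlinarith)
  have hB' : ((p + 1).factorial : ℝ) / (c ^ (p + 1) * B) ≤ s := hm₀ m hm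
  have hfac : (0 : ℝ) < (p + 1).factorial := by exact_mod_cast Nat.factorial_pos _
  have hcp : 0 < c ^ (p + 1) := pow_pos hc _
  -- assemble
  have h5 : Real.exp (-(x m)) * s ^ p ≤ ((p + 1).factorial : ℝ) / (c ^ (p + 1)) * (s ^ p / (s ^ a) ^ (p + 1)) := by
    have := mul_le_mul_of_nonneg_right h3 (pow_nonneg hs0.le p)
    rw [mul_pow] at this
    calc Real.exp (-(x m)) * s ^ p ≤ ((p + 1).factorial : ℝ) / (c ^ (p + 1) * (s ^ a) ^ (p + 1)) * s ^ p := this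
      _ = ((p + 1).factorial : ℝ) / (c ^ (p + 1)) * (s ^ p / (s ^ a) ^ (p + 1)) := by
          field_simp
  have h6 : s ^ p / (s ^ a) ^ (p + 1) ≤ 1 / s := by
    rw [div_le_div_iff₀ (by positivity) hs0, one_mul]
    exact h4
  have h7 : ((p + 1).factorial : ℝ) / (c ^ (p + 1)) * (1 / s) ≤ B := by
    rw [div_le_iff₀ (mul_pos hcp hB)] at hB'
    rw [mul_one_div, div_div, div_le_iff₀ (mul_pos hcp hs0)]
    nlinarith
  calc Real.exp (-(x m)) * s ^ p ≤ ((p + 1).factorial : ℝ) / (c ^ (p + 1)) * (s ^ p / (s ^ a) ^ (p + 1)) := h5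
    _ ≤ ((p + 1).factorial : ℝ) / (c ^ (p + 1)) * (1 / s) := mul_le_mul_of_nonneg_left h6 (by positivity)
    _ ≤ B := h7

end Summit.AnomalousDissipation.AnomalousDissipation.Theorems.SolenoidalFractalHomogenisation.LagrangianStep

end
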